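import Literature.IUT.HodgeTheaters.HodgeTheaterModelFKit
import HarnessLib

/-!
# `FKitLink(Mo, T, M)` is consistent: over EVERY initial Θ-datum `D`, a HodgeTheaterModel whose kinds are one-object
# groupoids on `{±1}` links to abc-iut-L5-t4's toy place kit (KIT-RULE inhabitant of `HodgeTheaterModel.FKitLink`)

S. Mochizuki, *Inter-universal Teichmüller theory I*, kurims manuscript (May 2020), Examples 3.2–3.5, Def 3.6 p. 87, Def 5.2
(i) p. 134, Rmk 5.2.1 p. 143 ([IUTchI] Def 5.2 (i) p.134) [claim: Mochizuki2012, status: disputed] (D-0012 claim key; CONSISTENCY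
MODEL for the dictionary `HodgeTheaterModel.FKitLink` of `HodgeTheaterModelFKit.lean` — nothing of the series is asserted,
no side is taken on [IUTchIII] Cor. 3.12).

The cell's KIT-RULE asks that every hypothesis structure be shown inhabited.  abc-iut-L5-t2's INTERFACE
`HodgeTheaterModel D` had no inhabitant in the tree ("interface without producer", census of abc-iut-w5-d056); this file
builds, for EVERY initial Θ-datum `D`,

* `HodgeTheaterModel.unitsModel D` — all kinds (`Loc`, `BaseFull`, `Dash`, `Base`, `Units`, `Glob`) the one-object groupoid on
  the group `{±1} = ℤˣ` ("isomorphs of the reference object, with automorphisms `±1`"), all constructions identity functors,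
  all tautological isomorphisms identities (KIT-RULE inhabitant of abc-iut-L5-t2's interface; no claim that it is print's
  model);
* `MultKit.trivialOf K'` — a multiplicative (§4-input) kit over ANY universe-0 base kit (one `𝒟^⊢`-strip object, empty `φ^Θ`), the
  shape of abc-iut-L5-t4's `MultKit.toy` freed from `toyKit`;
* `Model.unitsFunctor l : SingleObj ℤˣ ⥤ Model.Obj l` — the FULLY FAITHFUL functor onto the model `𝒟_v = loc` of abc-iut-L5-t4's
  collage category (`End(loc) = {±1}`), and with it
* **`HodgeTheaterModel.unitsLink D : (unitsModel D).FKitLink (PlaceKit.toy D) (MultKit.trivialOf _)`** — every field of the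
  §3↔§5 dictionary checked by the kernel (`cOf = 𝟭`, an equivalence everywhere; `baseAmb := unitsFunctor`, fully faithful,
  model to model) — and `exists_fKitLink`.

Consistency/plumbing only; typed ≠ proved elsewhere.
-/

namespace Literature.IUT.HodgeTheaters

open CategoryTheory

universe u v w

namespace PMBaseKit

/-! ### A multiplicative kit over any base kit; the fully faithful functor `{±1} ⥤ 𝒟_v` of the collage model -/

/-- **A multiplicative (§4-input) kit over ANY universe-`0` base kit** (the shape of abc-iut-L5-t4's `MultKit.toy`): one
`𝒟^⊢`-prime-strip object, identity mono-analyticisation on isomorphisms, EMPTY Example-4.4 poly-morphisms — consistency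
plumbing for [IUTchI] Def 4.1 (iii), (iv). ([IUTchI] Def 4.1 (iv) p.96) [claim: Mochizuki2012, status: disputed] -/
noncomputable def MultKit.trivialOf {l : ℕ} (K' : PMBaseKit.{0} l) : K'.MultKit where
  DMono := SingleObj Unit
  mono _ := SingleObj.star _
  monoMap _ := 𝟙 _
  thetaPolyBad _ _ _ := ∅

namespace Model

variable (l : ℕ) [Fact l.Prime]

/-- The functor `{±1} ⥤ 𝒟_v`: the one-object groupoid on `ℤˣ` onto the model `loc` of abc-iut-L5-t4's collage category
`Model.Obj l`, whose endomorphisms of `loc` ARE `ℤˣ` (model plumbing for [IUTchI] Def 4.1 (i): "isomorphs of `𝒟_v`").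
([IUTchI] Def 4.1 (i) p.95) [claim: Mochizuki2012, status: disputed] -/
def unitsFunctor : SingleObj ℤˣ ⥤ Obj l where
  obj _ := Obj.loc
  map f := f
  map_id _ := rfl
  map_comp _ _ := rfl

/-- `unitsFunctor` is fully faithful (`End(loc) = {±1}`). ([IUTchI] Def 4.1 (i) p.95) [claim: Mochizuki2012, status: disputed] -/
def unitsFunctorFullyFaithful : (unitsFunctor l).FullyFaithful where
  preimage f := f

end Model

end PMBaseKit

section Witness

variable {F : Type u} {K : Type v} {Fbar : Type w} [Field F] [NumberField F] [Field K]
  [NumberField K] [Algebra F K] [Field Fbar] [Algebra F Fbar] [Algebra K Fbar]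
  {E : WeierstrassCurve F} [E.IsElliptic] {l : ℕ} {P : BadPlacePredicates K}

namespace HodgeTheaterModel

/-- **An inhabitant of abc-iut-L5-t2's interface `HodgeTheaterModel D` for EVERY initial Θ-datum `D`** (KIT-RULE): every kind
of collection of data is the one-object groupoid on `{±1}` (one isomorphism class, automorphism group `ℤˣ`), every
"category-theoretic construction" the identity functor, every reference object the object, every tautological
isomorphism the identity; the two fullness LAWS hold for identity functors.  No claim that this is the model of Examples
3.2–3.5. ([IUTchI] Def 3.6 p.87) [claim: Mochizuki2012, status: disputed] -/
def unitsModel (D : InitialThetaData F K Fbar E l P) : HodgeTheaterModel.{u, v, w, 0} D where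
  Loc _ := SingleObj ℤˣ
  Fref _ := SingleObj.star _
  BaseFull _ := SingleObj ℤˣ
  baseFullOf _ := 𝟭 _
  Dash _ := SingleObj ℤˣ
  dashOf _ := 𝟭 _
  thetaOf _ := 𝟭 _
  tautLoc _ := Iso.refl _
  Base _ := SingleObj ℤˣ
  base _ := 𝟭 _
  dashOfBase _ := 𝟭 _
  baseCompat _ := Iso.refl _
  Units _ := SingleObj ℤˣ
  units _ := 𝟭 _
  Glob := SingleObj ℤˣ
  FmodRef := SingleObj.star _
  component _ := 𝟭 _
  componentRef _ := Iso.refl _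
  thtOf := 𝟭 _
  tautGlob := Iso.refl _

/-- **`FKitLink` is inhabited, over every initial Θ-datum**: the units model links to abc-iut-L5-t4's toy place kit
`PlaceKit.toy D` (its ambient categories are the collage category `Model.Obj l`, its model `𝒟_v = loc`) and the trivial
multiplicative kit — `LocC := {±1}`, `cOf = cBase = cDash = 𝟭` (so `cOf` is an equivalence at every place),
`baseAmb := unitsFunctor` (fully faithful, `⋆ ↦ loc`), realification and `𝒟^⊢`-side trivial; every field checked by the
kernel. ([IUTchI] Def 5.2 (i) p.134) [claim: Mochizuki2012, status: disputed] -/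
noncomputable def unitsLink (D : InitialThetaData F K Fbar E l P) :
    (unitsModel D).FKitLink (InitialThetaData.PlaceKit.toy D) (PMBaseKit.MultKit.trivialOf _) :=
  haveI : Fact l.Prime := ⟨D.l_prime⟩
  { LocC := fun _ => SingleObj ℤˣ
    cOf := fun _ => 𝟭 _
    cOf_isEquivalence := fun _ _ => Functor.isEquivalence_refl
    cBase := fun _ => 𝟭 _
    cBase_comp := fun _ => Iso.refl _
    cDash := fun _ => 𝟭 _
    cDash_comp := fun _ => Iso.refl _
    baseAmb := fun _ => PMBaseKit.Model.unitsFunctor l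
    baseAmbFF := fun _ => PMBaseKit.Model.unitsFunctorFullyFaithful l
    baseAmb_model := fun _ => Iso.refl _
    rlfOf := fun _ => (SingleObj.star ℤˣ : SingleObj ℤˣ)
    rlfOfMap := fun _ => Iso.refl (SingleObj.star ℤˣ)
    rlfFm_rlfOf := fun _ _ => Iso.refl (SingleObj.star ℤˣ)
    dmOf := fun _ => SingleObj.star Unit
    dmOfMap := fun _ => 𝟙 _
    dmOf_compat := fun _ _ => ⟨𝟙 _⟩ }

/-- **KIT-RULE for `FKitLink`**: for every initial Θ-datum `D` there exist a HodgeTheaterModel, a place kit (universe 0)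
and a multiplicative kit with an `FKitLink` between them — so the constructor `FKitLink.toFKit` and the theorems of
`HodgeTheaterModelFKit.lean` are not about an empty type. ([IUTchI] Def 5.2 (i) p.134) [claim: Mochizuki2012, status: disputed] -/
theorem exists_fKitLink (D : InitialThetaData F K Fbar E l P) :
    ∃ (Mo : HodgeTheaterModel.{u, v, w, 0} D) (T : InitialThetaData.PlaceKit.{0} D) (M : T.kit.MultKit),
      Nonempty (Mo.FKitLink T M) :=
  ⟨unitsModel D, InitialThetaData.PlaceKit.toy D, _, ⟨unitsLink D⟩⟩

/-- The constructed kit of the witness link has, as Θ-Hodge-theater local data, the one-object groupoid on `{±1}` (the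
constructor `FKitLink.toFKit` composes on the inhabitant). ([IUTchI] Def 3.6 p.87) [claim: Mochizuki2012, status: disputed] -/
theorem unitsLink_toFKit_ThAmb (D : InitialThetaData F K Fbar E l P) (x : (InitialThetaData.PlaceKit.toy D).kit.V) :
    (unitsLink D).toFKit.ThAmb x = SingleObj ℤˣ := rfl

end HodgeTheaterModel

end Witness

end Literature.IUT.HodgeTheaters
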